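/-
Copyright (c) 2026 the pub-hodgecm-mathlib formalisation cell (harness21).  Prover seat hodgecm-mathlib-K2E3-p20 (g5), Track B «K2-LIT» ∕ h413
(`stmt-HodgeConjecture-24833`), line `K2_E3_EllipticInputs`, unit U12 §L, kernel road «RICHARDSON» for (L-B_GL) at `N = 3` (road owner K2E3-p11 (g4)),
brick (R1d) «THE STRUCTURE OF `J(𝒩)(𝔤𝔩₃(F))` FROM THE TWO ORBIT MEASURES».  2026-09-04.
-/
import Summits.HodgeConjecture.HodgeConjecture.Theorems.K2E3GL3NilpotentOrbitUniqueness          -- ★ (R1c) p857342 (K2E3-p21 g4): one-orbit uniqueness ×2; brings ★ (R1b) p857319 docking, ★ (R1a) p857297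
import Summits.HodgeConjecture.HodgeConjecture.Theorems.K2E3GL2NilpotentStructureOfPuncturedCone   -- ★ p856851 (K2E3-p12 g3): `apply_eq_delta_add_of_eq_off_point`; ★ p856457 integer box
import HarnessLib

/-!
# K2_E3 road (h413), §L — kernel road «RICHARDSON» for (L-B_GL) at `N = 3`, brick (R1d): `J(𝒩)(𝔤𝔩₃(F)) = ℂδ₀ ⊕ ℂΛ_E ⊕ ℂΛ_J`

Cell `pub/hodgecm-mathlib` (D-0151), Track B, seat K2E3-p20 (g5); road owner K2E3-p11 (g4) (MEMO «ROW 11 — SPLIT ROAD» v1 §4 «RICHARDSON»), §L lead K2E3-p12 (g4),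
dealer K2E3-plan (g3).  `--supports stmt-HodgeConjecture-24833 --as helper`; THEOREMS ONLY (no definition ∕ instance ∕ notation ∕ named fact ∕ `sorry`); never imports
`Cruxes/…/Lines`.  COUNT-NEUTRAL ((L-B_GL) ∕ (LBGL-ge3) `sig_K2E3GLnNilpotentFourierRegularGeThree` stay OPEN).

THE STATEMENT (Harish-Chandra's Thm. 3.9 ∕ Cor. 3.10 for `𝔤𝔩₃`: `dim J(𝒩)` = number of nilpotent orbits = 3), HYPOTHESIS-STYLE over the two orbit measures exactly as
★ (R1c) binds `ν`.  `F` a non-archimedean local field, `𝔤 = Matrix (Fin 3) (Fin 3) F` (Borel structure), `E = E₁₃ = !![0,0,1;0,0,0;0,0,0]` (minimal orbit `Ad·E =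
{X² = 0, X ≠ 0}`), `J = !![0,1,0;0,0,1;0,0,0]` (regular orbit `Ad·J = {X³ = 0, X² ≠ 0}`).  Let `Λ_E`, `Λ_J` be measures on `𝔤`, finite on compacta, `Ad(GL₃(F))`-invariant
(`Ad(g)_* Λ = Λ`), carried by `Ad·E` resp. `Ad·J` (`Λ(orbitᶜ) = 0`) and non-zero — e.g. the Richardson measures of `P₍₁,₂₎` and of the Borel ((R2), road owner).  Then for
every `T : C_c^∞(𝔤) → ℂ` with the four `J(𝒩)` clauses of (L-B_GL) ∕ (LBGL-ge3) :635 at `N = 3` — additive, homogeneous, `Ad`-invariant, zero on test functions whose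
support meets no nilpotent —
  **`gl3_nilpotentStructure_of_orbitMeasures`: `∃ a b c : ℂ, ∀ f ∈ C_c^∞(𝔤), T f = a·f(0) + b·∫ f dΛ_E + c·∫ f dΛ_J`.**
§1 records that `f ↦ ∫ f dΛ` itself satisfies the four clauses for any such `Λ` carried by the nilpotent cone (so the sum is INTERNAL to `J(𝒩)`), and the
integrability ∕ additivity ∕ homogeneity ∕ invariance bookkeeping of these orbital functionals on `C_c^∞`.

THE PROOF (Howe ∕ Harish-Chandra stratification `𝒩 = Ad·J ⊔ Ad·E ⊔ {0}`, closure order `{0} < Ad·E < Ad·J`).  Dock `Λ_J` on `↥(Ad·J)` (★ (R1b)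
`smulInvariantMeasure_comap_val`, `isFiniteMeasureOnCompacts_comap_val`, `comap_val_ne_zero`, `integral_comp_val_comap_val`); ★ (R1c) `gl3_nilpotentUniqueness_nilpReg`
gives `c` with `T f = c·∫ f dΛ_J` whenever `X² ≠ 0` on `tsupport f`.  Then `T′ := T − c·Λ_J` is additive, homogeneous, invariant and KILLED BY THE OPEN STRATUM, so ★
(R1c) `gl3_nilpotentUniqueness_nilpMin` (with `Λ_E` docked on `↥(Ad·E)`) gives `b` with `T′ f = b·∫ f dΛ_E` whenever `0 ∉ tsupport f`; finally ★ p856851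
`apply_eq_delta_add_of_eq_off_point` (compact open integer box `∋ 0`) turns «`T′ = b·Λ_E` off `0`» into `T′ = a·δ₀ + b·Λ_E`.
[HarishChandra1999AdmissibleDistributions, §3 Thm. 3.9, Cor. 3.10 p. 10]; [Howe1974, Prop. 2]; [BernsteinZelevinsky1976, §1.18].

HONEST LABEL: HC_CM is proved only modulo the 7 printed citations (2 remaining named inputs: hLiu418 = stmt-HodgeConjecture-24832, h413 = stmt-HodgeConjecture-24833)
until rung 0 closes; count-neutral helper.

References: [HarishChandra1999AdmissibleDistributions] Harish-Chandra (DeBacker–Sally), AMS ULECT 16 (1999), §3 pp. 8–10, Thm. 3.9, Cor. 3.10 · [Howe1974] R. Howe,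
Math. Ann. 208 (1974), Prop. 2 · [BernsteinZelevinsky1976] Russian Math. Surveys 31:3 (1976), §1.18.
-/

set_option autoImplicit false
set_option linter.dupNamespace false   -- `Summit.HodgeConjecture.HodgeConjecture.…` (D-0017 nested layout; lakefile exemption for Summits)

noncomputable section

open MeasureTheory Measure Filter Topology TopologicalSpace
open scoped MatrixGroups NNReal ENNReal
open Literature.NumberTheory.Rogawski1990 Literature.NumberTheory.Automorphic
open Literature.NumberTheory.GaloisRepresentations Literature.NumberTheory.GaloisRepresentations.IsNonarchimedeanLocalField
open Summit.HodgeConjecture.HodgeConjecture.Cruxes.H413.K2E3GL3NilpotentOrbits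
open Summit.HodgeConjecture.HodgeConjecture.Cruxes.H413.K2E3GL3NilpotentOrbitSpaces
open Summit.HodgeConjecture.HodgeConjecture.Cruxes.H413.K2E3GL3NilpotentOrbitUniqueness
open Summit.HodgeConjecture.HodgeConjecture.Cruxes.H413.K2E3GLnNilpotentFourierPointSupport
open Summit.HodgeConjecture.HodgeConjecture.Cruxes.H413.K2E3GL2NilpotentStructureOfPuncturedCone

namespace Summit.HodgeConjecture.HodgeConjecture.Cruxes.H413.K2E3GL3NilpotentStructureOfOrbitMeasures

/-! ## §1  Orbital functionals `f ↦ ∫ f dΛ` on `C_c^∞`: integrability, additivity, homogeneity, invariance, support -/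

section Functional

variable {X : Type*} [TopologicalSpace X] [MeasurableSpace X] [OpensMeasurableSpace X] (Λ : Measure X) [IsFiniteMeasureOnCompacts Λ]

/-- A test function (locally constant, compact support) is `Λ`-integrable for every measure `Λ` finite on compacta.
[cite: HarishChandra1999AdmissibleDistributions, §3 p. 9] -/
theorem integrable_of_isLocSmooth {f : X → ℂ} (hf : IsLocSmooth f) : Integrable f Λ :=
  hf.continuous.integrable_of_hasCompactSupport hf.2

/-- `f ↦ ∫ f dΛ` is additive on `C_c^∞(X)`. [cite: HarishChandra1999AdmissibleDistributions, §3 p. 9] -/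
theorem integral_add_of_isLocSmooth {f₁ f₂ : X → ℂ} (h₁ : IsLocSmooth f₁) (h₂ : IsLocSmooth f₂) :
    ∫ x, (f₁ + f₂) x ∂Λ = ∫ x, f₁ x ∂Λ + ∫ x, f₂ x ∂Λ :=
  integral_add' (integrable_of_isLocSmooth Λ h₁) (integrable_of_isLocSmooth Λ h₂)

omit [TopologicalSpace X] [OpensMeasurableSpace X] [IsFiniteMeasureOnCompacts Λ] in
/-- `f ↦ ∫ f dΛ` is homogeneous. [cite: HarishChandra1999AdmissibleDistributions, §3 p. 9] -/
theorem integral_smul_apply (a : ℂ) (f : X → ℂ) : ∫ x, (a • f) x ∂Λ = a * ∫ x, f x ∂Λ := by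
  simp only [Pi.smul_apply, smul_eq_mul]
  exact integral_const_mul a f

end Functional

section GL3Functional

variable {F : Type*} [Field F] [TopologicalSpace F] [IsTopologicalRing F]
  [MeasurableSpace (Matrix (Fin 3) (Fin 3) F)] [BorelSpace (Matrix (Fin 3) (Fin 3) F)] (Λ : Measure (Matrix (Fin 3) (Fin 3) F))

/-- **`Ad`-invariance of `f ↦ ∫ f dΛ`** for an `Ad(GL₃(F))`-invariant measure `Λ` (`Ad(g)_* Λ = Λ`) and continuous `f`: `∫ f(gXg⁻¹) dΛ(X) = ∫ f dΛ`.
[cite: HarishChandra1999AdmissibleDistributions, §3 pp. 8–10] -/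
theorem integral_comp_conj_eq
    (hΛ : ∀ g : GL (Fin 3) F, Λ.map (fun Y : Matrix (Fin 3) (Fin 3) F => (g : Matrix (Fin 3) (Fin 3) F) * Y * ((g⁻¹ : GL (Fin 3) F) : Matrix (Fin 3) (Fin 3) F)) = Λ)
    (g : GL (Fin 3) F) {f : Matrix (Fin 3) (Fin 3) F → ℂ} (hf : Continuous f) :
    ∫ X, f ((g : Matrix (Fin 3) (Fin 3) F) * X * ((g⁻¹ : GL (Fin 3) F) : Matrix (Fin 3) (Fin 3) F)) ∂Λ = ∫ X, f X ∂Λ := by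
  have hAd : Measurable fun Y : Matrix (Fin 3) (Fin 3) F => (g : Matrix (Fin 3) (Fin 3) F) * Y * ((g⁻¹ : GL (Fin 3) F) : Matrix (Fin 3) (Fin 3) F) :=
    (continuous_conj g).measurable
  have h := integral_map (μ := Λ) hAd.aemeasurable (f := f) (by rw [hΛ g]; exact hf.aestronglyMeasurable)
  rw [hΛ g] at h
  exact h.symm

omit [IsTopologicalRing F] [BorelSpace (Matrix (Fin 3) (Fin 3) F)] in
/-- **SUPPORT CLAUSE (iv) for an orbital functional**: if `Λ` is carried by a set `𝒪` of nilpotent matrices (`Λ(𝒪ᶜ) = 0`), then `∫ f dΛ = 0` for every `f` whose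
support meets no nilpotent. [cite: HarishChandra1999AdmissibleDistributions, §3 p. 9] -/
theorem integral_eq_zero_of_forall_not_isNilpotent {𝒪 : Set (Matrix (Fin 3) (Fin 3) F)} (hO : ∀ X ∈ 𝒪, IsNilpotent X) (h0 : Λ 𝒪ᶜ = 0)
    {f : Matrix (Fin 3) (Fin 3) F → ℂ} (hf : ∀ X ∈ tsupport f, ¬ IsNilpotent X) : ∫ X, f X ∂Λ = 0 := by
  have hae : ∀ᵐ X ∂Λ, X ∈ 𝒪 := mem_ae_iff.2 h0
  have hzero : f =ᵐ[Λ] 0 := by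
    filter_upwards [hae] with X hX
    by_contra hfX
    exact hf X (subset_tsupport f hfX) (hO X hX)
  rw [integral_congr_ae hzero]
  simp

/-- **THE FOUR `J(𝒩)` CLAUSES FOR `f ↦ ∫ f dΛ`** (`Λ` finite on compacta, `Ad`-invariant, carried by a set of nilpotents — e.g. by `Ad·E₁₃` or `Ad·J`): additive,
homogeneous, `Ad(GL₃(F))`-invariant on `C_c^∞(𝔤𝔩₃(F))`, and zero on test functions whose support meets no nilpotent — LETTER FOR LETTER the hypothesis block of
(LBGL-ge3) at `N = 3`.  So `Λ_E`, `Λ_J` are themselves in `J(𝒩)` and the decomposition of §2 is internal. [cite: HarishChandra1999AdmissibleDistributions, §3 p. 9, Thm. 3.9] -/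
theorem integral_JN_clauses [IsFiniteMeasureOnCompacts Λ]
    (hΛ : ∀ g : GL (Fin 3) F, Λ.map (fun Y : Matrix (Fin 3) (Fin 3) F => (g : Matrix (Fin 3) (Fin 3) F) * Y * ((g⁻¹ : GL (Fin 3) F) : Matrix (Fin 3) (Fin 3) F)) = Λ)
    {𝒪 : Set (Matrix (Fin 3) (Fin 3) F)} (hO : ∀ X ∈ 𝒪, IsNilpotent X) (h0 : Λ 𝒪ᶜ = 0) :
    (∀ f₁ f₂ : Matrix (Fin 3) (Fin 3) F → ℂ, IsLocSmooth f₁ → IsLocSmooth f₂ → ∫ X, (f₁ + f₂) X ∂Λ = ∫ X, f₁ X ∂Λ + ∫ X, f₂ X ∂Λ) ∧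
    (∀ (a : ℂ) (f : Matrix (Fin 3) (Fin 3) F → ℂ), IsLocSmooth f → ∫ X, (a • f) X ∂Λ = a * ∫ X, f X ∂Λ) ∧
    (∀ (x : GL (Fin 3) F) (f : Matrix (Fin 3) (Fin 3) F → ℂ), IsLocSmooth f →
      ∫ X, f ((x : Matrix (Fin 3) (Fin 3) F) * X * ((x⁻¹ : GL (Fin 3) F) : Matrix (Fin 3) (Fin 3) F)) ∂Λ = ∫ X, f X ∂Λ) ∧
    (∀ f : Matrix (Fin 3) (Fin 3) F → ℂ, IsLocSmooth f → (∀ X ∈ tsupport f, ¬ IsNilpotent X) → ∫ X, f X ∂Λ = 0) :=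
  ⟨fun _ _ h₁ h₂ => integral_add_of_isLocSmooth Λ h₁ h₂, fun a f _ => integral_smul_apply Λ a f,
    fun x _ hf => integral_comp_conj_eq Λ hΛ x hf.continuous, fun _ _ hf => integral_eq_zero_of_forall_not_isNilpotent Λ hO h0 hf⟩

end GL3Functional

/-- A non-zero measure carried by `𝒪` charges `𝒪`. [folklore] -/
theorem measure_ne_zero_of_compl_eq_zero {X : Type*} [MeasurableSpace X] (Λ : Measure X) {𝒪 : Set X} (h0 : Λ 𝒪ᶜ = 0) (hne : Λ ≠ 0) : Λ 𝒪 ≠ 0 := by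
  intro h
  apply hne
  rw [← measure_univ_eq_zero, ← Set.union_compl_self 𝒪]
  exact le_antisymm ((measure_union_le _ _).trans (by rw [h, h0, add_zero])) bot_le

/-! ## §2  `J(𝒩)(𝔤𝔩₃(F)) = ℂδ₀ ⊕ ℂΛ_E ⊕ ℂΛ_J` -/

section Structure

variable {F : Type*} [Field F] [ValuativeRel F] [TopologicalSpace F] [IsNonarchimedeanLocalField F]

/-- **(R1d) THE STRUCTURE OF `J(𝒩)(𝔤𝔩₃(F))`.**  `Λ_E`, `Λ_J`: measures on `𝔤𝔩₃(F)` finite on compacta, `Ad(GL₃(F))`-invariant, carried by the minimal orbit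
`Ad·E₁₃` resp. the regular orbit `Ad·J`, non-zero.  Then every `T` with the four `J(𝒩)` clauses of (L-B_GL) at `N = 3` — (i) additive, (ii) homogeneous, (iii)
`Ad`-invariant on `C_c^∞(𝔤𝔩₃(F))`, (iv) zero on test functions whose support meets no nilpotent — is `a·δ₀ + b·Λ_E + c·Λ_J` on `C_c^∞(𝔤𝔩₃(F))`.
(Harish-Chandra: `dim J(𝒩) =` number of nilpotent orbits `= 3` for `𝔤𝔩₃`.)
[cite: HarishChandra1999AdmissibleDistributions, §3 Thm. 3.9, Cor. 3.10 p. 10] [cite: Howe1974, Prop. 2] [cite: BernsteinZelevinsky1976, §1.18] -/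
theorem gl3_nilpotentStructure_of_orbitMeasures [MeasurableSpace (Matrix (Fin 3) (Fin 3) F)] [BorelSpace (Matrix (Fin 3) (Fin 3) F)]
    (ΛE ΛJ : Measure (Matrix (Fin 3) (Fin 3) F)) [IsFiniteMeasureOnCompacts ΛE] [IsFiniteMeasureOnCompacts ΛJ]
    (hΛE : ∀ g : GL (Fin 3) F, ΛE.map (fun Y : Matrix (Fin 3) (Fin 3) F => (g : Matrix (Fin 3) (Fin 3) F) * Y * ((g⁻¹ : GL (Fin 3) F) : Matrix (Fin 3) (Fin 3) F)) = ΛE)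
    (hΛJ : ∀ g : GL (Fin 3) F, ΛJ.map (fun Y : Matrix (Fin 3) (Fin 3) F => (g : Matrix (Fin 3) (Fin 3) F) * Y * ((g⁻¹ : GL (Fin 3) F) : Matrix (Fin 3) (Fin 3) F)) = ΛJ)
    (hE0 : ΛE (MulAction.orbit (ConjAct (GL (Fin 3) F)) (!![0, 0, 1; 0, 0, 0; 0, 0, 0] : Matrix (Fin 3) (Fin 3) F))ᶜ = 0) (hEne : ΛE ≠ 0)
    (hJ0 : ΛJ (MulAction.orbit (ConjAct (GL (Fin 3) F)) (!![0, 1, 0; 0, 0, 1; 0, 0, 0] : Matrix (Fin 3) (Fin 3) F))ᶜ = 0) (hJne : ΛJ ≠ 0)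
    (T : (Matrix (Fin 3) (Fin 3) F → ℂ) → ℂ)
    (hT : (∀ f₁ f₂ : Matrix (Fin 3) (Fin 3) F → ℂ, IsLocSmooth f₁ → IsLocSmooth f₂ → T (f₁ + f₂) = T f₁ + T f₂) ∧
       (∀ (a : ℂ) (f : Matrix (Fin 3) (Fin 3) F → ℂ), IsLocSmooth f → T (a • f) = a * T f) ∧
       (∀ (x : GL (Fin 3) F) (f : Matrix (Fin 3) (Fin 3) F → ℂ), IsLocSmooth f →
          T (fun X => f ((x : Matrix (Fin 3) (Fin 3) F) * X * ((x⁻¹ : GL (Fin 3) F) : Matrix (Fin 3) (Fin 3) F))) = T f) ∧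
       (∀ f : Matrix (Fin 3) (Fin 3) F → ℂ, IsLocSmooth f → (∀ X ∈ tsupport f, ¬ IsNilpotent X) → T f = 0)) :
    ∃ a b c : ℂ, ∀ f : Matrix (Fin 3) (Fin 3) F → ℂ, IsLocSmooth f →
      T f = a * f 0 + b * ∫ X, f X ∂ΛE + c * ∫ X, f X ∂ΛJ := by
  haveI : T2Space F := (isLocalField F).toT2Space
  obtain ⟨hT1, hT2, hT3, hT4⟩ := hT
  -- the two orbits are Borel
  have hOJ : MeasurableSet (MulAction.orbit (ConjAct (GL (Fin 3) F)) (!![0, 1, 0; 0, 0, 1; 0, 0, 0] : Matrix (Fin 3) (Fin 3) F)) :=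
    measurableSet_orbit_nilpReg
  have hOE : MeasurableSet (MulAction.orbit (ConjAct (GL (Fin 3) F)) (!![0, 0, 1; 0, 0, 0; 0, 0, 0] : Matrix (Fin 3) (Fin 3) F)) :=
    measurableSet_orbit_nilpMin
  -- STEP 1 (regular stratum): dock `Λ_J` on `↥(Ad·J)` and apply (R1c) off `{X² = 0}`
  haveI := smulInvariantMeasure_comap_val hOJ ΛJ hΛJ
  haveI := isFiniteMeasureOnCompacts_comap_val hOJ ΛJ
  have hνJ := comap_val_ne_zero hOJ ΛJ (measure_ne_zero_of_compl_eq_zero ΛJ hJ0 hJne)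
  obtain ⟨c, hc⟩ := gl3_nilpotentUniqueness_nilpReg _ hνJ T ⟨hT1, hT2, hT3, hT4⟩
  have hc' : ∀ f : Matrix (Fin 3) (Fin 3) F → ℂ, IsLocSmooth f → (∀ X ∈ tsupport f, X * X ≠ 0) → T f = c * ∫ X, f X ∂ΛJ := fun f hf hf2 => by
    rw [hc f hf hf2, integral_comp_val_comap_val hOJ ΛJ hJ0]
  -- STEP 2 (minimal stratum): `T′ := T − c·Λ_J` is in `J(𝒩)` and killed by the open stratum; dock `Λ_E` on `↥(Ad·E)` and apply (R1c) off `0`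
  set T' : (Matrix (Fin 3) (Fin 3) F → ℂ) → ℂ := fun f => T f - c * ∫ X, f X ∂ΛJ with hT'def
  have hT'1 : ∀ f₁ f₂ : Matrix (Fin 3) (Fin 3) F → ℂ, IsLocSmooth f₁ → IsLocSmooth f₂ → T' (f₁ + f₂) = T' f₁ + T' f₂ := fun f₁ f₂ h₁ h₂ => by
    simp only [hT'def, hT1 f₁ f₂ h₁ h₂, integral_add_of_isLocSmooth ΛJ h₁ h₂]
    ring
  have hT'2 : ∀ (a : ℂ) (f : Matrix (Fin 3) (Fin 3) F → ℂ), IsLocSmooth f → T' (a • f) = a * T' f := fun a f hf => by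
    simp only [hT'def, hT2 a f hf, integral_smul_apply ΛJ a f]
    ring
  have hT'3 : ∀ (x : GL (Fin 3) F) (f : Matrix (Fin 3) (Fin 3) F → ℂ), IsLocSmooth f →
      T' (fun X => f ((x : Matrix (Fin 3) (Fin 3) F) * X * ((x⁻¹ : GL (Fin 3) F) : Matrix (Fin 3) (Fin 3) F))) = T' f := fun x f hf => by
    simp only [hT'def, hT3 x f hf, integral_comp_conj_eq ΛJ hΛJ x hf.continuous]
  have hT'5 : ∀ f : Matrix (Fin 3) (Fin 3) F → ℂ, IsLocSmooth f → (∀ X ∈ tsupport f, X * X ≠ 0) → T' f = 0 := fun f hf hf2 => by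
    simp only [hT'def, hc' f hf hf2, sub_self]
  haveI := smulInvariantMeasure_comap_val hOE ΛE hΛE
  haveI := isFiniteMeasureOnCompacts_comap_val hOE ΛE
  have hνE := comap_val_ne_zero hOE ΛE (measure_ne_zero_of_compl_eq_zero ΛE hE0 hEne)
  obtain ⟨b, hb⟩ := gl3_nilpotentUniqueness_nilpMin _ hνE T' hT'1 hT'2 hT'3 hT'5
  have hb' : ∀ f : Matrix (Fin 3) (Fin 3) F → ℂ, IsLocSmooth f → (0 : Matrix (Fin 3) (Fin 3) F) ∉ tsupport f → T' f = b * ∫ X, f X ∂ΛE :=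
    fun f hf hf0 => by rw [hb f hf hf0, integral_comp_val_comap_val hOE ΛE hE0]
  -- STEP 3 (the point `0`): what is left of `T′` is supported at `0`, hence `a·δ₀` (★ p856851, compact open integer box `∋ 0`)
  have hpt : ∃ a : ℂ, ∀ f : Matrix (Fin 3) (Fin 3) F → ℂ, IsLocSmooth f → T' f = a * f 0 + b * ∫ X, f X ∂ΛE := by
    obtain ⟨hBo, hBc, hB0⟩ := isOpen_isCompact_matrixIntegerBox (F := F) (N := 3)
    exact ⟨_, fun f hf => apply_eq_delta_add_of_eq_off_point hBo hBc hB0 T' (fun g => ∫ X, g X ∂ΛE) hT'1 hT'2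
      (fun f₁ f₂ h₁ h₂ => integral_add_of_isLocSmooth ΛE h₁ h₂) (fun a g _ => integral_smul_apply ΛE a g) b hb' hf⟩
  obtain ⟨a, ha⟩ := hpt
  refine ⟨a, b, c, fun f hf => ?_⟩
  have h := ha f hf
  simp only [hT'def] at h
  linear_combination h

end Structure

end Summit.HodgeConjecture.HodgeConjecture.Cruxes.H413.K2E3GL3NilpotentStructureOfOrbitMeasures

end
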